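import Summits.HodgeConjecture.HodgeConjecture.Theorems.Ring2AbelianAllTensorWeilCarriersDefs
import Summits.HodgeConjecture.HodgeConjecture.Theorems.VHCAbelianSchemesRoadServedFibreLocal
import Literature.AlgebraicGeometry.HodgeTheory.WeilClassesTensorPointAlgebraic
import HarnessLib

/-!
# Ring 2 / AbelianAll (André column) × the Weil ladder — THE TENSOR-ANCHOR JUNCTION: door ∧ carriers for WEIL classes at TENSOR points ⟹
# the ladder's local tensor-anchor predicate ⟹ (Deligne's family) every Weil class for `K = ℚ(√-p)`; `WeilSixfoldsSqrtMinus7` and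
# `WeilTenfoldsSqrtMinus11` from the road's binders and ONE carrier node each

research route, not a corollary; conditional on HC_CM plus one named minimal statement.

PART AB (gen 59) served ALL algebraic classes at elliptic-power anchors. What André's Lemme 6.3.3 actually needs at its special fibre is a
carrier for a WEIL CLASS of the TENSOR POINT `V₀ ⊗ K` — for imaginary quadratic `K = ℚ(√-p)` exactly the anchor family of the Weil ladder
(`b2b-hweil`: Deligne 1982 Thm. 4.8 (b) `A₀ ⊗ K`; van Geemen 5.3–5.7). The span of classes of abelian subvarieties at such a point is the whole
Lefschetz space, so «served := algebraic» cannot be cut by a span condition; the honest minimum is the Weil PLANE itself (per structure), which the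
tree types (`weilClassesOf`). PART AC-b (`Ring2AbelianAllTensorWeilCarriersDefs`) names the node `TensorWeilCarriers 𝒪 k p` /
`TensorWeilTwistedCarriers k p`; this file proves:

* §1 **`hasLocallyAlgebraicTensorAnchors_of_door_of_tensorWeilCarriers : LocalVariationalHodgeFor 𝒪 → TensorWeilCarriers 𝒪 k p →
  HodgeTheory.HasLocallyAlgebraicTensorAnchors k p`** — the JUNCTION: the road's per-variety carrier statement at tensor points, fed through the
  door by the LOCAL served-fibre lemma (PART AC-a, smooth base of any dimension, relative hyperplane class as `Θ`), gives the ladder's local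
  predicate with `H = 0`, `q = 0` (the class `W` itself is algebraic near the tensor point). Twisted form per `C`.
* §2 Lattice: `AbelianDesigns 𝒪 ⟹ TensorWeilCarriers 𝒪 k p` (`k ≥ 2`, `p ≥ 1`: the served Weil classes are ALGEBRAIC on tensor points,
  `weilClassesOf_le_algebraicClasses_of_tensorPoint`, so PART Z's pinned design restricts), twisted form.
* The ROWS (ladder theorem composed: every Weil class for `ℚ(√-p)`, `p ≡ 3 (4)` prime `≥ 7`; the cruxes `WeilSixfoldsSqrtMinus7` /
  `WeilTenfoldsSqrtMinus11` from the road's binders and `TensorWeilTwistedCarriers 3 7` / `5 11`) are the companion LEAF file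
  `Ring2AbelianAllTensorWeilCarriersRows` (it imports route files; this file does not, so that it can be imported route-independently).

HONEST: both carrier nodes are OPEN, not in print, NOT implied by the Hodge conjecture; `deligne1982_weilFamily_hodgeWeilSection` is the ladder's
NAMED FACT (Deligne, LNM 900, proof of Thm. 4.8; a theorem in print, by name); the door is the road's binder `TwistedPerfectDoor` (labels and
caveats of the route file apply: for `AdmTw`'s `bfSingleAdmissible` disjunct the binder is citation-expected for `B₀ = 0` — Buchweitz–Flenner
Thm. 5.1 — and for degree sets `I` with `{q | q+1 ∈ I}` an initial segment; see RING2-MAP §AbelianAll AA2.487 for the `B₀ ≠ 0` slice).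
Nothing here says any carrier, door, Weil crux, `HC_CM`, `HC_AV` or HC holds; `HC_CM` does not occur. References:
[cite: Deligne1982HodgeCycles, §4 Thm. 4.8 (a)–(c), Lemma 4.5, Remark 4.10] [cite: Andre1996Motifs, Lemme 6.3.3 and proof (p. 33)]
[cite: vanGeemen1994HodgeAV, 4.9, Lemma 5.2, 5.3–5.7] [cite: BuchweitzFlenner2003, §5 Thm. 5.1] [cite: Bloch1972Semiregularity, Remark (7.5)]
[cite: Markman2025SecantWeil, Thm. 1.4.1, §1.5 and §7.3] [cite: Pridham2024Semiregularity, Cor. 2.25 and Rem. 2.26–2.27].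
-/

noncomputable section

open CategoryTheory CategoryTheory.Limits AlgebraicGeometry Topology

namespace Summit.HodgeConjecture.HodgeConjecture.Ring2.AbelianAll

-- the cell's namespace repeats the summit name (`Summit.HodgeConjecture.HodgeConjecture…`), as in every `Ring2*` file
set_option linter.dupNamespace false

open Literature.AlgebraicGeometry Literature.AlgebraicGeometry.Motives
open Literature.AlgebraicGeometry.HodgeTheory
open Literature.AlgebraicTopology.SingularHomology
open Summit.Ventures.HSemireg (ObjClass LocalVariationalHodgeFor)
open Summit.HodgeConjecture.HodgeConjecture.Ring2.SemiregularRepresentatives (AnchoredCarrierAt PinnedDesignAt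
  twistedPerfectDoorVHC_iff_localVariationalHodgeFor anchoredCarrierAt_of_pinnedDesignAt
  exists_isOpen_forall_mem_algebraicClasses_of_anchoredCarrierAt_of_polarised)

variable {𝒪 : ObjClass} {k p : ℕ}

/-! ## §1 The junction: door ∧ carriers for Weil classes at tensor points ⟹ the ladder's local tensor-anchor predicate -/

/-- **THE TENSOR-ANCHOR JUNCTION**: the door's local variational Hodge statement and CARRIERS FOR WEIL CLASSES AT TENSOR POINTS give the Weil
ladder's `HasLocallyAlgebraicTensorAnchors k p` — with `H = 0`, `q = 0`: at the tensor point `Y ≅ 𝒳_{s₀}` the fibre with the relative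
hyperplane class is a polarised tensor anchor, the rational Weil class `x = e₀^*(W|_{s₀})` is served, and the LOCAL served-fibre lemma
(PART AC-a, base of any dimension) makes `W|_{𝒳_s}` algebraic on an open `U ∋ s₀`. Door-generic, fact-free.
[cite: BuchweitzFlenner2003, §5 Thm. 5.1] [cite: Deligne1982HodgeCycles, §4 Thm. 4.8 (b)] [cite: Bloch1972Semiregularity, Remark (7.5)] -/
theorem hasLocallyAlgebraicTensorAnchors_of_door_of_tensorWeilCarriers (hT : LocalVariationalHodgeFor 𝒪) (hcar : TensorWeilCarriers 𝒪 k p) :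
    HasLocallyAlgebraicTensorAnchors k p := by
  intro Y Ψ hY hΨ hpt x hx hxQ 𝒳 S f hf h𝒳 hS _ hsm _ W hW s₀ e₀ he₀
  haveI : IsSeparated S.hom := hS.isSeparated
  have hanc : ∃ (Y' : AbelianVariety ℂ) (Ψ' : Y' ⟶ Y'), IsTensorPoint k p Y' Ψ' ∧ Nonempty (Y'.X ≅ fiberOver f s₀) :=
    ⟨Y, Ψ, ⟨hY, hΨ, hpt⟩, ⟨e₀⟩⟩
  have hserved : complexBetti.map (fiberι f s₀) (2 * k) W ∈
      {w | ∃ (Y' : AbelianVariety ℂ) (Ψ' : Y' ⟶ Y') (e : Y'.X ≅ fiberOver f s₀),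
        IsTensorPoint k p Y' Ψ' ∧ complexBetti.map e.hom (2 * k) w ∈ weilClassesOf Y' Ψ' k p} :=
    ⟨Y, Ψ, e₀, ⟨hY, hΨ, hpt⟩, by rw [he₀]; exact hx⟩
  obtain ⟨U, hUo, hU₀, halg⟩ := exists_isOpen_forall_mem_algebraicClasses_of_anchoredCarrierAt_of_polarised
    (𝔄₀ := fun X ↦ ∃ (Y' : AbelianVariety ℂ) (Ψ' : Y' ⟶ Y'), IsTensorPoint k p Y' Ψ' ∧ Nonempty (Y'.X ≅ X))
    (𝔖₀ := fun X ↦ {w | ∃ (Y' : AbelianVariety ℂ) (Ψ' : Y' ⟶ Y') (e : Y'.X ≅ X),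
      IsTensorPoint k p Y' Ψ' ∧ complexBetti.map e.hom (2 * k) w ∈ weilClassesOf Y' Ψ' k p})
    hT hcar hf h𝒳 hsm W hW s₀ hanc hserved
  refine ⟨U, 0, 0, hUo, hU₀, fun s ↦ ?_, fun s hs ↦ ?_⟩
  · rw [map_zero]
    exact ⟨IsRationalClass.zero, isOfHodgeType_zero_of_isSmoothProjective nonempty_hodgeModel_holds (hf.isSmoothProjective s) _ _ _⟩
  · rw [Rat.cast_zero, zero_smul, zero_add]
    exact halg s hs

/-- **Twisted-door form of the junction, per `C`** (route binder `TwistedPerfectDoorVHC C AdmTw` by name, any admissibility notion).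
[cite: Pridham2024Semiregularity, Cor. 2.25 and Rem. 2.26–2.27] [cite: BuchweitzFlenner2003, §5 Thm. 5.1] [cite: Deligne1982HodgeCycles, §4 Thm. 4.8 (b)] -/
theorem hasLocallyAlgebraicTensorAnchors_of_twistedPerfectDoorVHC_of_tensorWeilCarriers {C : ChernCharacterBetti} {Adm : PerfectAdmissibility}
    (hT : TwistedPerfectDoorVHC C Adm) (hcar : TensorWeilCarriers (twistedReflexiveClass C Adm) k p) :
    HasLocallyAlgebraicTensorAnchors k p :=
  hasLocallyAlgebraicTensorAnchors_of_door_of_tensorWeilCarriers ((twistedPerfectDoorVHC_iff_localVariationalHodgeFor C Adm).1 hT) hcar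

/-! ## §2 Lattice: the designs node dominates the tensor-Weil node -/

/-- **Served Weil classes at tensor anchors are ALGEBRAIC** (Deligne's Remark 4.10 on the split square, moved along the `K`-isogeny pair —
the tree's `weilClassesOf_le_algebraicClasses_of_tensorPoint` — and along `e : Y.X ≅ X`); `k, p ≥ 1`.
[cite: Deligne1982HodgeCycles, §4 Lemma 4.5 and Remark 4.10] [cite: vanGeemen1994HodgeAV, 3.6–3.7] -/
theorem mem_algebraicClasses_of_mem_tensorWeilServedClasses (hk : 0 < k) (hp : 0 < p) {X : SchemeOver ℂ} {θ : complexBetti X 2}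
    {w : complexBetti X (2 * k)} (hw : w ∈ tensorWeilServedClasses k p X θ) : w ∈ algebraicClasses X k := by
  obtain ⟨Y, Ψ, e, ⟨hY, -, hpt⟩, hx⟩ := hw
  exact (mem_algebraicClasses_map_iff_of_iso e).1 (mem_algebraicClasses_of_tensorPoint hk hp hY hpt hx)

/-- **`PinnedDesignAt 𝒪 (2k) k ⟹ TensorWeilCarriers 𝒪 k p`** (`k, p ≥ 1`): tensor anchors are polarised abelian `2k`-folds and the served Weil
classes are algebraic, so PART Z's pinned design problem restricts (`anchoredCarrierAt_of_pinnedDesignAt`).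
[cite: Bloch1972Semiregularity, Remark (7.5)] [cite: Deligne1982HodgeCycles, §4 Remark 4.10] -/
theorem tensorWeilCarriers_of_pinnedDesignAt (hk : 0 < k) (hp : 0 < p) (h : PinnedDesignAt 𝒪 (2 * k) k) : TensorWeilCarriers 𝒪 k p :=
  anchoredCarrierAt_of_pinnedDesignAt h
    (fun _ _ hXθ ↦ ⟨by obtain ⟨⟨Y, Ψ, ⟨hY, -, -⟩, he⟩, -⟩ := hXθ; exact ⟨Y, hY, he⟩, hXθ.2⟩)
    fun _ _ _ _ hw ↦ mem_algebraicClasses_of_mem_tensorWeilServedClasses hk hp hw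

/-- **`AbelianDesigns 𝒪 ⟹ TensorWeilCarriers 𝒪 k p`** for `k ≥ 2`, `p ≥ 1` (the cell `(2k, k)` is in the mid-range `2 ≤ k ≤ 2k − 2`).
[cite: Bloch1972Semiregularity, Remark (7.5)] [cite: Deligne1982HodgeCycles, §4 Remark 4.10] -/
theorem tensorWeilCarriers_of_abelianDesigns (hk : 2 ≤ k) (hp : 0 < p) (h : AbelianDesigns 𝒪) : TensorWeilCarriers 𝒪 k p :=
  tensorWeilCarriers_of_pinnedDesignAt (by omega) hp (h (2 * k) k hk (by omega))

/-- Twisted form: `AbelianTwistedDesigns ⟹ TensorWeilTwistedCarriers k p` (`k ≥ 2`, `p ≥ 1`). [cite: Bloch1972Semiregularity, Remark (7.5)]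
[cite: Markman2025SecantWeil, §7.3] -/
theorem tensorWeilTwistedCarriers_of_abelianTwistedDesigns (hk : 2 ≤ k) (hp : 0 < p) (h : AbelianTwistedDesigns) :
    TensorWeilTwistedCarriers k p :=
  fun C ↦ tensorWeilCarriers_of_abelianDesigns hk hp (h C)

end Summit.HodgeConjecture.HodgeConjecture.Ring2.AbelianAll

end
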